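import Literature.Probability.Percolation.TriMarkedDomainOfDarts
import Literature.Probability.Percolation.MarkedLoopBoundarySupport
import HarnessLib

/-!
# Which stretch a boundary dart lies on: positions, and the stretches of `TriMarkedDomain.ofDarts` («STRETCH-OF-DARTS»)

Topic `Literature/Probability/Percolation`; family `crit-perc` / marked-loop lineage; a rider on `TriMarkedDomainOfDarts.lean` («TRI-MARK-DARTS»: ★★★ `TriMarkedDomain.ofDarts` — marking a
discrete domain at a finite set `S` of locally-markable darts, positions `dartPos` = the sorted visit times, rebased at the first), `TriDiscInterface.lean` (`TriMarkedDomain.dpos` — the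
position of a boundary dart on the cycle, `iter_dpos`, `dpos_eq_of_iter_eq`, `dpos_lt`) and `MarkedLoopBoundarySupport.lean` (`pos_facts_of_mem_stretch`).

To USE a marked domain produced by `ofDarts` one must know on which stretch `A_i` (the darts from the `i`-th marked dart up to the next) a given boundary dart lies — e.g. to read a
boundary mid-edge `z` on the home arc (`ArcPoint`, `ArcPoint.ofFlatDart`). This file answers it by positions alone:

* `visitTime_eq_dpos` — ERRATUM/BRIDGE: the `visitTime` of «TRI-MARK-DARTS» is the tree's `TriMarkedDomain.dpos` (same definition; the duplicate name is kept for the landed file and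
  bridged here by `rfl`);
* ★ `mem_stretch_iff_dpos` — for ANY marked domain: `d ∈ A_i ⟺ d` is a boundary dart with `pos i ≤ dpos d < nextPos i` (converse of `pos_facts_of_mem_stretch`);
* `dartPos_lt_card`, `dartPos_zero_le` — the positions of `ofDarts` are visit times `< #∂`, the first is the least;
* `ofDarts_base` / `ofDarts_pos` / `ofDarts_bdryLen` — the data of `ofDarts` (definitional);
* ★★ `mem_stretch_ofDarts_iff` (`i + 1 < k`) / ★★ `mem_stretch_ofDarts_last_iff` — **THE STRETCHES OF `ofDarts` BY VISIT TIME FROM THE OLD BASE**: `d ∈ A_i ⟺ dartPos i ≤ dpos d <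
  dartPos (i+1)`, and for the last stretch `⟺ dartPos (k−1) ≤ dpos d ∨ dpos d < dartPos 0` (it wraps through the old base).

## References
* B. Bollobás, O. Riordan, *Percolation*, CUP (2006), Ch. 7 §7.2.2 pp. 168–169 (the boundary cycle; the arcs `A_i` between consecutive marked sites).

## Mathlib / tree
Tree: `TriMarkedDomainOfDarts` (`ofDarts`, `dartPos`, `exists_visitTime_eq_dartPos`, `dartPos_strictMono`, `visitTime_lt`), `TriDiscInterface` (`dpos`, `iter_dpos`, `dpos_eq_of_iter_eq`,
`dpos_lt`), `MarkedLoopBoundarySupport` (`pos_facts_of_mem_stretch`), `TriDiscShelling` (`triBdryIter_add`, `IsTriDisc.iter_add_card`, `card_pos`), `TriDiscreteDomain` (`stretch`,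
`nextPos`, `bdryLen`, `triBdryIter_mem`). Mathlib: `Finset.mem_image`, `Finset.mem_Ico`.
-/

noncomputable section

open Finset Literature.Probability.LatticeModels

namespace Literature.Probability.Percolation

namespace TriMarkedDomain

variable {j : ℕ} (D : TriMarkedDomain j)

/-! ### Positions -/

/-- **BRIDGE**: the visit time of «TRI-MARK-DARTS» is the tree's dart position `dpos` (identical definitions). [cite: BollobasRiordan2006, Ch. 7 §7.2.2 p. 168 (the boundary cycle); lane plumbing] -/
theorem visitTime_eq_dpos (d : Site 2 × Site 2) : D.visitTime d = D.dpos d := rfl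

/-- ★ **a boundary dart lies on the stretch `A_i` iff its position lies in `[pos i, nextPos i)`** (any marked domain).
[cite: BollobasRiordan2006, Ch. 7 §7.2.2 p. 169 (the arcs between consecutive marked sites)] -/
theorem mem_stretch_iff_dpos (i : Fin j) (d : Site 2 × Site 2) :
    d ∈ D.stretch i ↔ d ∈ triBdryDarts D.verts ∧ D.pos i ≤ D.dpos d ∧ D.dpos d < D.nextPos i := by
  constructor
  · intro hd
    obtain ⟨h1, h2, -, -, h5⟩ := MarkedLoops.pos_facts_of_mem_stretch hd
    exact ⟨h5, h1, h2⟩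
  · rintro ⟨hd, h1, h2⟩
    exact Finset.mem_image.2 ⟨D.dpos d, Finset.mem_Ico.2 ⟨h1, h2⟩, D.iter_dpos hd⟩

variable {k : ℕ}

/-- the positions of `ofDarts` are visit times, hence `< #∂`. [cite: BollobasRiordan2006, Ch. 7 §7.2.2 p. 168; lane plumbing] -/
theorem dartPos_lt_card (S : Finset (Site 2 × Site 2)) (hmem : ∀ d ∈ S, d ∈ triBdryDarts D.verts) (hT : #(D.visitTimes S) = k) (i : Fin k) :
    D.dartPos S hT i < #(triBdryDarts D.verts) := by
  obtain ⟨d, hd, e⟩ := D.exists_visitTime_eq_dartPos S hT i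
  rw [← e]
  exact D.visitTime_lt (hmem d hd)

/-- the first position is the least. [cite: BollobasRiordan2006, Ch. 7 §7.2.2 p. 168; lane plumbing] -/
theorem dartPos_zero_le (hk : 0 < k) (S : Finset (Site 2 × Site 2)) (hT : #(D.visitTimes S) = k) (i : Fin k) :
    D.dartPos S hT ⟨0, hk⟩ ≤ D.dartPos S hT i :=
  (D.dartPos_strictMono S hT).monotone (Fin.mk_le_mk.2 (Nat.zero_le _))

/-! ### The data of `ofDarts` -/

/-- the card identity behind the positions of `ofDarts`. [cite: BollobasRiordan2006, Ch. 7 §7.2.2 p. 168; lane plumbing] -/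
theorem card_visitTimes_of_markable (S : Finset (Site 2 × Site 2)) (hcard : #S = k) (hS : ∀ d ∈ S, IsMarkable D.verts d) : #(D.visitTimes S) = k :=
  (D.card_visitTimes fun d hd => (hS d hd).mem).trans hcard

section OfDarts

variable (hk : 0 < k) (S : Finset (Site 2 × Site 2)) (hcard : #S = k) (hS : ∀ d ∈ S, IsMarkable D.verts d)
  (hinj : Set.InjOn Prod.fst (S : Set (Site 2 × Site 2)))

/-- the base of `ofDarts` is the dart at the first position. [cite: BollobasRiordan2006, Ch. 7 §7.2.2 p. 168; lane plumbing] -/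
theorem ofDarts_base : (D.ofDarts hk S hcard hS hinj).base =
    triBdryIter D.verts D.base (D.dartPos S (D.card_visitTimes_of_markable S hcard hS) ⟨0, hk⟩) := rfl

/-- the positions of `ofDarts`, rebased. [cite: BollobasRiordan2006, Ch. 7 §7.2.2 p. 169; lane plumbing] -/
theorem ofDarts_pos (i : Fin k) : (D.ofDarts hk S hcard hS hinj).pos i =
    D.dartPos S (D.card_visitTimes_of_markable S hcard hS) i - D.dartPos S (D.card_visitTimes_of_markable S hcard hS) ⟨0, hk⟩ := rfl

/-- the boundary length of `ofDarts`. [cite: BollobasRiordan2006, Ch. 7 §7.2.2 p. 168; lane plumbing] -/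
theorem ofDarts_bdryLen : (D.ofDarts hk S hcard hS hinj).bdryLen = #(triBdryDarts D.verts) := rfl

/-- the boundary walk of `ofDarts` is the old walk shifted by the first position. [cite: BollobasRiordan2006, Ch. 7 §7.2.2 p. 168; lane plumbing] -/
theorem triBdryIter_ofDarts_base (n : ℕ) : triBdryIter (D.ofDarts hk S hcard hS hinj).verts (D.ofDarts hk S hcard hS hinj).base n =
    triBdryIter D.verts D.base (D.dartPos S (D.card_visitTimes_of_markable S hcard hS) ⟨0, hk⟩ + n) := by
  rw [ofDarts_verts, ofDarts_base, ← triBdryIter_add]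

/-- ★★ **THE STRETCHES OF `ofDarts` (all but the last)**: for `i + 1 < k`, a dart lies on the stretch `A_i` of the marked domain iff it is a boundary dart whose position from the OLD base
satisfies `dartPos i ≤ dpos d < dartPos (i+1)`. [cite: BollobasRiordan2006, Ch. 7 §7.2.2 p. 169 (the arcs between consecutive marked sites)] -/
theorem mem_stretch_ofDarts_iff (i : Fin k) (hi : i.val + 1 < k) (d : Site 2 × Site 2) :
    d ∈ (D.ofDarts hk S hcard hS hinj).stretch i ↔ d ∈ triBdryDarts D.verts ∧
      D.dartPos S (D.card_visitTimes_of_markable S hcard hS) i ≤ D.dpos d ∧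
        D.dpos d < D.dartPos S (D.card_visitTimes_of_markable S hcard hS) ⟨i.val + 1, hi⟩ := by
  set hT := D.card_visitTimes_of_markable S hcard hS with hTdef
  set q := D.dartPos S hT with hq
  have hmem : ∀ d ∈ S, d ∈ triBdryDarts D.verts := fun d hd => (hS d hd).mem
  have hq0 : ∀ i, q ⟨0, hk⟩ ≤ q i := D.dartPos_zero_le hk S hT
  have hqL : ∀ i, q i < #(triBdryDarts D.verts) := D.dartPos_lt_card S hmem hT
  have hnext : (D.ofDarts hk S hcard hS hinj).nextPos i = q ⟨i.val + 1, hi⟩ - q ⟨0, hk⟩ := by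
    unfold TriMarkedDomain.nextPos; rw [dif_pos hi]; rfl
  unfold TriMarkedDomain.stretch
  rw [hnext]
  constructor
  · intro hd
    obtain ⟨n, hn, rfl⟩ := Finset.mem_image.1 hd
    rw [Finset.mem_Ico] at hn
    change (D.ofDarts hk S hcard hS hinj).pos i ≤ n ∧ _ at hn
    rw [ofDarts_pos] at hn
    rw [triBdryIter_ofDarts_base]
    have h0 := hq0 i; have h1 := hq0 ⟨i.val + 1, hi⟩; have hL := hqL ⟨i.val + 1, hi⟩
    have hlt : q ⟨0, hk⟩ + n < #(triBdryDarts D.verts) := by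
      change q i - q ⟨0, hk⟩ ≤ n ∧ n < q ⟨i.val + 1, hi⟩ - q ⟨0, hk⟩ at hn; omega
    refine ⟨triBdryIter_mem D.base_mem _, ?_, ?_⟩
    · rw [D.dpos_eq_of_iter_eq hlt rfl]; change q i - q ⟨0, hk⟩ ≤ n ∧ _ at hn; omega
    · rw [D.dpos_eq_of_iter_eq hlt rfl]; change _ ∧ n < q ⟨i.val + 1, hi⟩ - q ⟨0, hk⟩ at hn; omega
  · rintro ⟨hd, h1, h2⟩
    change q i ≤ D.dpos d at h1; change D.dpos d < q ⟨i.val + 1, hi⟩ at h2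
    have h0 := hq0 i
    refine Finset.mem_image.2 ⟨D.dpos d - q ⟨0, hk⟩, Finset.mem_Ico.2 ?_, ?_⟩
    · change (D.ofDarts hk S hcard hS hinj).pos i ≤ _ ∧ _
      rw [ofDarts_pos]; change q i - q ⟨0, hk⟩ ≤ _ ∧ _ < q ⟨i.val + 1, hi⟩ - q ⟨0, hk⟩; omega
    · rw [triBdryIter_ofDarts_base]
      change triBdryIter D.verts D.base (q ⟨0, hk⟩ + (D.dpos d - q ⟨0, hk⟩)) = d
      rw [show q ⟨0, hk⟩ + (D.dpos d - q ⟨0, hk⟩) = D.dpos d by omega, D.iter_dpos hd]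

/-- ★★ **THE LAST STRETCH OF `ofDarts`** (from the last marked dart round to the first): a dart lies on it iff it is a boundary dart with `dartPos (k−1) ≤ dpos d` or `dpos d < dartPos 0`
— the stretch wraps through the old base. [cite: BollobasRiordan2006, Ch. 7 §7.2.2 p. 169 (the arcs between consecutive marked sites)] -/
theorem mem_stretch_ofDarts_last_iff (i : Fin k) (hi : ¬ i.val + 1 < k) (d : Site 2 × Site 2) :
    d ∈ (D.ofDarts hk S hcard hS hinj).stretch i ↔ d ∈ triBdryDarts D.verts ∧
      (D.dartPos S (D.card_visitTimes_of_markable S hcard hS) i ≤ D.dpos d ∨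
        D.dpos d < D.dartPos S (D.card_visitTimes_of_markable S hcard hS) ⟨0, hk⟩) := by
  set hT := D.card_visitTimes_of_markable S hcard hS with hTdef
  set q := D.dartPos S hT with hq
  set L := #(triBdryDarts D.verts) with hLdef
  have hmem : ∀ d ∈ S, d ∈ triBdryDarts D.verts := fun d hd => (hS d hd).mem
  have hq0 : ∀ i, q ⟨0, hk⟩ ≤ q i := D.dartPos_zero_le hk S hT
  have hqL : ∀ i, q i < L := D.dartPos_lt_card S hmem hT
  have hnext : (D.ofDarts hk S hcard hS hinj).nextPos i = L := by
    unfold TriMarkedDomain.nextPos; rw [dif_neg hi]; rfl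
  have hper := D.isTriDisc.iter_add_card
  unfold TriMarkedDomain.stretch
  rw [hnext]
  constructor
  · intro hd
    obtain ⟨n, hn, rfl⟩ := Finset.mem_image.1 hd
    rw [Finset.mem_Ico] at hn
    change (D.ofDarts hk S hcard hS hinj).pos i ≤ n ∧ n < L at hn
    rw [ofDarts_pos] at hn
    change q i - q ⟨0, hk⟩ ≤ n ∧ n < L at hn
    rw [triBdryIter_ofDarts_base]
    change triBdryIter D.verts D.base (q ⟨0, hk⟩ + n) ∈ _ ∧ (q i ≤ _ ∨ _ < q ⟨0, hk⟩)
    refine ⟨triBdryIter_mem D.base_mem _, ?_⟩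
    have h0 := hq0 i; have hiL := hqL i
    by_cases hlt : q ⟨0, hk⟩ + n < L
    · left; rw [D.dpos_eq_of_iter_eq hlt rfl]; omega
    · right
      have e : triBdryIter D.verts D.base (q ⟨0, hk⟩ + n) = triBdryIter D.verts D.base (q ⟨0, hk⟩ + n - L) := by
        conv_lhs => rw [show q ⟨0, hk⟩ + n = (q ⟨0, hk⟩ + n - L) + L by omega]
        exact hper _
      rw [e, D.dpos_eq_of_iter_eq (by omega) rfl]; omega
  · rintro ⟨hd, h⟩
    change q i ≤ D.dpos d ∨ D.dpos d < q ⟨0, hk⟩ at h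
    have h0 := hq0 i; have hiL := hqL i; have hdL := D.dpos_lt hd
    rcases h with h | h
    · refine Finset.mem_image.2 ⟨D.dpos d - q ⟨0, hk⟩, Finset.mem_Ico.2 ?_, ?_⟩
      · change (D.ofDarts hk S hcard hS hinj).pos i ≤ _ ∧ _ < L
        rw [ofDarts_pos]; change q i - q ⟨0, hk⟩ ≤ _ ∧ _; omega
      · rw [triBdryIter_ofDarts_base]
        change triBdryIter D.verts D.base (q ⟨0, hk⟩ + (D.dpos d - q ⟨0, hk⟩)) = d
        rw [show q ⟨0, hk⟩ + (D.dpos d - q ⟨0, hk⟩) = D.dpos d by omega, D.iter_dpos hd]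
    · refine Finset.mem_image.2 ⟨D.dpos d + L - q ⟨0, hk⟩, Finset.mem_Ico.2 ?_, ?_⟩
      · change (D.ofDarts hk S hcard hS hinj).pos i ≤ _ ∧ _ < L
        rw [ofDarts_pos]; change q i - q ⟨0, hk⟩ ≤ _ ∧ _; omega
      · rw [triBdryIter_ofDarts_base]
        change triBdryIter D.verts D.base (q ⟨0, hk⟩ + (D.dpos d + L - q ⟨0, hk⟩)) = d
        rw [show q ⟨0, hk⟩ + (D.dpos d + L - q ⟨0, hk⟩) = D.dpos d + L by omega, hper, D.iter_dpos hd]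

end OfDarts

end TriMarkedDomain

end Literature.Probability.Percolation
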